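import Summits.KontsevichZagierPeriods.KontsevichZagierPeriods.Theorems.OctahedralSymmetryOctahedralSpanAllWeightsDefs
import Mathlib.Algebra.BigOperators.Fin

/-!
# Crux `OctahedralSpanAllWeights` (stmt-KontsevichZagierPeriods-9659), line `Sketch`:
# stub `StubWeightTwo`

Registered stub `stub_weight_two : TwoLetterNormalForm 2` of the lead's skeleton (vocabulary of
`OctahedralSymmetryOctahedralSpanAllWeightsDefs`): each of the 16 convergent level-4 words of
length 2 is, modulo the relation module `rel` (involution, distribution, finite double shuffle,
shuffle lifts), a `ℚ`-combination of the 4 words over the poles `±i` (letters `1`, `3`).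

Method — proof by reflection, kernel-checked (`decide +kernel`, no `native_decide`), following
`MzvKernelInKZTwoPosetsEdsCertificateLow` / `LinRedNormalFormHoffmanSpanInKZCertCheck` (this tree):
formal combinations `FVec5` realised in `WordQ` by `FVec5.eval`, with the bridge
`eval (ofZTerms L) = toQ (ofTerms L)` (Part 1); a linear-time radix zero test `FVec5.zeroTest`,
sound by `eval_eq_zero_of_zeroTest` (Part 2); computable formal generators `invF`, `dilF`, `fdsF`,
`liftF`, computed literally from `LevelFour.expand sigmaLetter / dilLetter`, `stuffleIdx`, `word`,
`MZV.shuffleWord` and realising to `invGen`, `dilGen`, `fdsGen`, `liftMap` (Part 3); generator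
terms `GenTerm` with Boolean side conditions, `isGen_eval : g.ok → IsGen (eval g.vecF)` (Part 4);
certificates `Cert`, the checker `Cert.ok w`, `Cert.sound : c.ok w → sym c.word ∈ rel ⊔ twoSpan w`
and the table lemma `twoLetterNormalForm_of_table` — the interface the weight-3 stub reuses with
its own table (Part 5); the weight-2 table `certs2` (12 certificates, ≤ 11 generator terms each,
denominators in `{1, 3, 6}`), `certs2_ok` and the coverage `certs2_cover` by one `decide +kernel`
each, and `stub_weight_two` (Part 6).

Sources: J. Zhao, *Standard relations of multiple polylogarithm values at roots of unity*,
Doc. Math. 15 (2010), §2 (shuffle, stuffle, finite double shuffle), §5 (distribution); J. Zhao,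
*Multiple polylogarithm values at roots of unity*, C. R. Acad. Sci. Paris 346 (2008), §4 (the
involution); P. Deligne, Publ. IHÉS 112 (2010) (`d(2,4) = 4`). Not here: weights `≥ 3` (separate
stubs); independence of the four two-letter words modulo `rel`.
-/

noncomputable section

namespace Summit.KontsevichZagierPeriods.OctahedralSymmetry.OctaSpan

open Literature.NumberTheory.Transcendental Literature.NumberTheory.Transcendental.LevelFour

/-! ## Part 1. Formal `ℚ`-combinations of level-4 words (Parts 1–5: the generic checker) -/

/-- Formal `ℚ`-combinations of level-4 words: association lists with repetitions. [folklore] -/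
abbrev FVec5 : Type := List (List (Fin 5) × ℚ)

namespace FVec5

/-- Realisation of a formal combination in the free module `WordQ`. [folklore] -/
def eval (v : FVec5) : WordQ := (v.map fun p => p.2 • sym p.1).sum

/-- Scalar multiple of a formal combination. [folklore] -/
def smul (q : ℚ) (v : FVec5) : FVec5 := v.map fun p => (p.1, q * p.2)

/-- Cast of an integral term list (the input format of `LevelFour.ofTerms`). [folklore] -/
def ofZTerms (L : List (ℤ × List (Fin 5))) : FVec5 := L.map fun p => (p.2, (p.1 : ℚ))

/-- Realisation of a combination with a leading term. [folklore] -/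
@[simp] theorem eval_cons (p : List (Fin 5) × ℚ) (v : FVec5) :
    eval (p :: v) = p.2 • sym p.1 + eval v := by simp [eval]

/-- Realisation is additive under concatenation. [folklore] -/
@[simp] theorem eval_append (u v : FVec5) : eval (u ++ v) = eval u + eval v := by
  simp [eval, List.sum_append]

/-- Realisation commutes with scalar multiplication. [folklore] -/
@[simp] theorem eval_smul (q : ℚ) (v : FVec5) : eval (smul q v) = q • eval v := by
  simp [eval, smul, List.smul_sum, List.map_map, Function.comp_def, smul_smul]

/-- Realisation of a concatenation of combinations indexed by a list. [folklore] -/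
theorem eval_flatMap {α : Type*} (l : List α) (g : α → FVec5) :
    eval (l.flatMap g) = (l.map fun a => eval (g a)).sum := by
  induction l with
  | nil => simp [eval]
  | cons a l ih => simp [ih]

/-- **The bridge to the tree's `ℤ`-combinations** `LevelFour.ofTerms`. [folklore] -/
theorem eval_ofZTerms (L : List (ℤ × List (Fin 5))) : eval (ofZTerms L) = toQ (ofTerms L) := by
  induction L with
  | nil => simp [ofZTerms, eval]
  | cons p L ih =>
    simp only [ofZTerms, List.map_cons, eval_cons, ofTerms_cons, map_add, toQ_single] at ih ⊢
    rw [ih, Int.cast_smul_eq_zsmul]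

/-! ## Part 2. A linear-time radix zero test (cf. `LinRedNormalFormHoffmanSpanInKZCertCheck`):
bucket by the first letter, `n` structural passes; soundness via the prefix-generalised `evalP` -/

/-- Total coefficient of the empty word. [folklore] -/
def constCoeff : FVec5 → ℚ
  | [] => 0
  | ([], c) :: v => constCoeff v + c
  | (_ :: _, _) :: v => constCoeff v

/-- The tails of the words starting with the letter `a`, with their coefficients. [folklore] -/
def tails (a : Fin 5) : FVec5 → FVec5
  | [] => []
  | ([], _) :: v => tails a v
  | (b :: t, c) :: v => if b = a then (t, c) :: tails a v else tails a v

/-- The radix zero test with fuel `n` (`n = w + 1` for words of length `w`): the empty word has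
total coefficient `0` and, recursively, every bucket of tails passes; nothing left at fuel `0`.
[folklore] -/
def zeroTest : ℕ → FVec5 → Bool
  | 0, v => v.isEmpty
  | n + 1, v => decide (constCoeff v = 0) && (zeroTest n (tails 0 v) && (zeroTest n (tails 1 v) &&
      (zeroTest n (tails 2 v) && (zeroTest n (tails 3 v) && zeroTest n (tails 4 v)))))

/-- Prefix-generalised realisation: the word `p.1` is read after the prefix `pre`. [folklore] -/
def evalP (pre : List (Fin 5)) (v : FVec5) : WordQ := (v.map fun p => p.2 • sym (pre ++ p.1)).sum

/-- Generalised realisation of a combination with a leading term. [folklore] -/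
@[simp] theorem evalP_cons (pre : List (Fin 5)) (p : List (Fin 5) × ℚ) (v : FVec5) :
    evalP pre (p :: v) = p.2 • sym (pre ++ p.1) + evalP pre v := by simp [evalP]

/-- One bucketing step on a leading nonempty word. [folklore] -/
theorem evalP_tails_cons (q : List (Fin 5)) (a b : Fin 5) (t : List (Fin 5)) (c : ℚ) (v : FVec5) :
    evalP q (tails a ((b :: t, c) :: v)) =
      (if b = a then c • sym (q ++ t) else 0) + evalP q (tails a v) := by
  rw [tails]
  split_ifs <;> simp

/-- **The split is exact**: empty-word part plus the five buckets after the longer prefixes.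
[folklore] -/
theorem evalP_split (pre : List (Fin 5)) (v : FVec5) :
    evalP pre v = constCoeff v • sym pre + ∑ a : Fin 5, evalP (pre ++ [a]) (tails a v) := by
  induction v with
  | nil => simp [evalP, constCoeff, tails]
  | cons p v ih =>
    obtain ⟨w, c⟩ := p
    cases w with
    | nil =>
      simp only [evalP_cons, List.append_nil, constCoeff, tails, ih, add_smul]
      abel
    | cons b t =>
      simp only [evalP_cons, constCoeff, evalP_tails_cons, Finset.sum_add_distrib,
        Finset.sum_ite_eq, Finset.mem_univ, if_true, ih, List.append_assoc, List.singleton_append]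
      abel

/-- **Soundness of the radix zero test** (prefix form). [folklore] -/
theorem evalP_eq_zero_of_zeroTest :
    ∀ (n : ℕ) (pre : List (Fin 5)) (v : FVec5), zeroTest n v = true → evalP pre v = 0
  | 0, pre, v, h => by
    rw [zeroTest, List.isEmpty_iff] at h
    simp [h, evalP]
  | n + 1, pre, v, h => by
    simp only [zeroTest, Bool.and_eq_true, decide_eq_true_eq] at h
    obtain ⟨h0, h1, h2, h3, h4, h5⟩ := h
    rw [evalP_split, h0, zero_smul, zero_add, Fin.sum_univ_five,
      evalP_eq_zero_of_zeroTest n _ _ h1, evalP_eq_zero_of_zeroTest n _ _ h2,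
      evalP_eq_zero_of_zeroTest n _ _ h3, evalP_eq_zero_of_zeroTest n _ _ h4,
      evalP_eq_zero_of_zeroTest n _ _ h5]
    simp

/-- **Soundness of the radix zero test**: if `zeroTest n v` accepts, `eval v = 0`. [folklore] -/
theorem eval_eq_zero_of_zeroTest {n : ℕ} {v : FVec5} (h : zeroTest n v = true) : eval v = 0 := by
  simpa [evalP, eval] using evalP_eq_zero_of_zeroTest n [] v h

end FVec5

open FVec5

/-! ## Part 3. Computable formal versions of the generators (literally from the tree's executable
`LevelFour.expand`, `sigmaLetter`, `dilLetter`, `stuffleIdx`, `word`, `MZV.shuffleWord`) -/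

/-- Formal shuffle product `u ш v`. [folklore] -/
def shuffleF (u v : List (Fin 5)) : FVec5 :=
  ofZTerms ((MZV.shuffleWord u v).map fun w => ((1 : ℤ), w))

/-- `shuffleF` realises to `toQ (shuffle u v)`. [folklore] -/
theorem eval_shuffleF (u v : List (Fin 5)) : eval (shuffleF u v) = toQ (shuffle u v) := by
  rw [shuffleF, shuffle, eval_ofZTerms]

/-- Formal involution generator `[W] − sigmaSubst W` (expand by `sigmaLetter`, reverse, sign
`(-1)^{|W|}`). [folklore] -/
def invF (W : List (Fin 5)) : FVec5 :=
  (W, 1) :: smul (-(((-1 : ℤ) ^ W.length : ℤ) : ℚ))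
    (ofZTerms ((expand sigmaLetter W).map fun cV => (cV.1, cV.2.reverse)))

/-- `invF` realises to `invGen`. [folklore] -/
theorem eval_invF (W : List (Fin 5)) : eval (invF W) = invGen W := by
  rw [invF, eval_cons, eval_smul, eval_ofZTerms, invGen, sigmaSubst, map_zsmul, one_smul, neg_smul,
    Int.cast_smul_eq_zsmul, sub_eq_add_neg]

/-- Formal distribution generator `[W] − dilSubst W`. [folklore] -/
def dilF (W : List (Fin 5)) : FVec5 := (W, 1) :: smul (-1) (ofZTerms (expand dilLetter W))

/-- `dilF` realises to `dilGen`. [folklore] -/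
theorem eval_dilF (W : List (Fin 5)) : eval (dilF W) = dilGen W := by
  rw [dilF, eval_cons, eval_smul, eval_ofZTerms, dilGen, dilSubst, one_smul, neg_one_smul,
    sub_eq_add_neg]

/-- Formal finite double shuffle generator
`∑_{m ∈ k ∗ l} (-1)^{|k|+|l|+|m|} [word m] − word k ш word l`. [folklore] -/
def fdsF (k l : List (ℕ × Fin 4)) : FVec5 :=
  ofZTerms ((stuffleIdx k l).map fun m => ((-1 : ℤ) ^ (k.length + l.length + m.length), word m)) ++
    smul (-1) (shuffleF (word k) (word l))

/-- `fdsF` realises to `fdsGen`. [folklore] -/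
theorem eval_fdsF (k l : List (ℕ × Fin 4)) : eval (fdsF k l) = fdsGen k l := by
  rw [fdsF, eval_append, eval_smul, eval_ofZTerms, eval_shuffleF, fdsGen, stuffleSigned,
    neg_one_smul, sub_eq_add_neg]

/-- Formal shuffle lift by the word `u`: `∑ c • (u ш V)` over the terms `(V, c)`. [folklore] -/
def liftF (u : List (Fin 5)) (v : FVec5) : FVec5 := v.flatMap fun p => smul p.2 (shuffleF u p.1)

/-- `liftF u` realises to `liftMap u`. [folklore] -/
theorem eval_liftF (u : List (Fin 5)) (v : FVec5) : eval (liftF u v) = liftMap u (eval v) := by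
  induction v with
  | nil => simp [liftF, eval]
  | cons p v ih =>
    have hc : liftF u (p :: v) = smul p.2 (shuffleF u p.1) ++ liftF u v := rfl
    rw [hc, eval_append, ih, eval_smul, eval_shuffleF, eval_cons, map_add, map_smul, sym, liftMap,
      Finsupp.linearCombination_single, one_smul]

/-! ## Part 4. Generator terms -/

/-- **Generator terms**, the syntax of the generators `IsGen` of `rel`: `inv W` for `invGen W`,
`dil W` for `dilGen W`, `fds k l` for `fdsGen k l`, `lift u g` for `liftMap u (vec g)`.
[folklore] -/
inductive GenTerm : Type
  | inv (W : List (Fin 5))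
  | dil (W : List (Fin 5))
  | fds (k l : List (ℕ × Fin 4))
  | lift (u : List (Fin 5)) (g : GenTerm)

namespace GenTerm

/-- The side conditions of the `IsGen` constructors, as a Boolean. [folklore] -/
def ok : GenTerm → Bool
  | inv W => decide (IsConvergent W)
  | dil W => decide (IsConvergent W) && decide (IsLevelTwo W)
  | fds k l => decide (IsConvergentIdx k) && decide (IsConvergentIdx l)
  | lift u g => decide (IsConvergent u) && g.ok

/-- The formal vector of a generator term. [folklore] -/
def vecF : GenTerm → FVec5
  | inv W => invF W
  | dil W => dilF W
  | fds k l => fdsF k l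
  | lift u g => liftF u g.vecF

/-- **Soundness of generator terms**: an accepted term realises to a generator (so into `rel`, by
`mem_rel_of_isGen`). [folklore] -/
theorem isGen_eval : ∀ g : GenTerm, g.ok = true → IsGen (eval g.vecF)
  | inv W, h => by simpa only [vecF, eval_invF] using IsGen.inv (by simpa [ok] using h)
  | dil W, h => by
    simp only [ok, Bool.and_eq_true, decide_eq_true_eq] at h
    simpa only [vecF, eval_dilF] using IsGen.dil h.1 h.2
  | fds k l, h => by
    simp only [ok, Bool.and_eq_true, decide_eq_true_eq] at h
    simpa only [vecF, eval_fdsF] using IsGen.fds h.1 h.2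
  | lift u g, h => by
    simp only [ok, Bool.and_eq_true, decide_eq_true_eq] at h
    simpa only [vecF, eval_liftF] using IsGen.lift h.1 (isGen_eval g h.2)

end GenTerm

/-! ## Part 5. Certificates, the checker, and tables -/

/-- A certificate for one convergent word `word`: its normal form `nf` (two-letter words `V` of
the same length with coefficients `y_V`) and generator terms `gens` (`g` with coefficient `x_g`),
claiming `[word] − Σ y_V [V] = Σ x_g vec(g)`. [folklore] -/
structure Cert where
  /-- the word -/
  word : List (Fin 5)
  /-- the normal form: two-letter words of the same length, with coefficients -/
  nf : FVec5
  /-- generator terms with coefficients -/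
  gens : List (GenTerm × ℚ)

namespace Cert

/-- The formal expansion of `[word] − (Σ y_V [V] + Σ x_g vec(g))`. [folklore] -/
def fvec (c : Cert) : FVec5 :=
  (c.word, 1) :: smul (-1) (c.nf ++ c.gens.flatMap fun p => smul p.2 p.1.vecF)

/-- **The checker** at weight `w`: the normal-form words are two-letter words of length `w`
(`mem_twoWords_iff`), the generator terms pass `GenTerm.ok`, the expansion vanishes. [folklore] -/
def ok (w : ℕ) (c : Cert) : Bool :=
  c.nf.all (fun p => decide (p.1.length = w ∧ ∀ a ∈ p.1, a = 1 ∨ a = 3)) &&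
    (c.gens.all (fun p => p.1.ok) && zeroTest (w + 1) c.fvec)

/-- The formal expansion realises to the difference of the two sides of the certificate
identity. [folklore] -/
theorem eval_fvec (c : Cert) :
    eval c.fvec = sym c.word - (eval c.nf + (c.gens.map fun p => p.2 • eval p.1.vecF).sum) := by
  simp only [fvec, eval_cons, eval_smul, eval_append, eval_flatMap, one_smul, neg_one_smul]
  abel

/-- **Soundness of the checker**: an accepted certificate puts its word in `rel ⊔ twoSpan w`.
[folklore] -/
theorem sound (w : ℕ) (c : Cert) (h : c.ok w = true) : sym c.word ∈ rel ⊔ twoSpan w := by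
  simp only [ok, Bool.and_eq_true, List.all_eq_true, decide_eq_true_eq] at h
  obtain ⟨hnf, hg, hz⟩ := h
  have h0 := eval_eq_zero_of_zeroTest hz
  rw [eval_fvec, sub_eq_zero] at h0
  rw [h0, add_comm]
  refine Submodule.add_mem_sup (list_sum_mem fun x hx => ?_) (list_sum_mem fun x hx => ?_)
  · obtain ⟨p, hp, rfl⟩ := List.mem_map.1 hx
    exact Submodule.smul_mem _ _ (mem_rel_of_isGen (GenTerm.isGen_eval p.1 (hg p hp)))
  · obtain ⟨p, hp, rfl⟩ := List.mem_map.1 hx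
    refine Submodule.smul_mem _ _ (Submodule.subset_span ⟨p.1, ?_, rfl⟩)
    exact Finset.mem_coe.2 ((mem_twoWords_iff w p.1).2 (hnf p hp))

end Cert

/-- All words of length `n` (the enumeration used by the coverage check). [folklore] -/
def allWords : ℕ → List (List (Fin 5))
  | 0 => [[]]
  | n + 1 => (List.finRange 5).flatMap fun a => (allWords n).map (List.cons a)

/-- A word `W` is enumerated by `allWords |W|`. [folklore] -/
theorem mem_allWords : ∀ W : List (Fin 5), W ∈ allWords W.length
  | [] => List.mem_singleton.2 rfl
  | a :: W => List.mem_flatMap.2 ⟨a, List.mem_finRange a, List.mem_map.2 ⟨W, mem_allWords W, rfl⟩⟩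

/-- **From a checked table to `TwoLetterNormalForm w`**: every certificate of `T` passes the
checker at weight `w`, and every convergent word of length `w` is a two-letter word or the word of
a certificate of `T` (both hypotheses by `decide +kernel`). [folklore] -/
theorem twoLetterNormalForm_of_table (w : ℕ) (T : List Cert) (hT : T.all (Cert.ok w) = true)
    (hcover : ∀ W ∈ allWords w, IsConvergent W →
      (∀ a ∈ W, a = 1 ∨ a = 3) ∨ W ∈ T.map Cert.word) :
    TwoLetterNormalForm w := by
  intro W hlen hW
  subst hlen
  rcases hcover W (mem_allWords W) hW with h2 | hmem
  · exact Submodule.mem_sup_right (Submodule.subset_span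
      ⟨W, Finset.mem_coe.2 ((mem_twoWords_iff _ W).2 ⟨rfl, h2⟩), rfl⟩)
  · obtain ⟨c, hc, rfl⟩ := List.mem_map.1 hmem
    exact Cert.sound _ c (List.all_eq_true.1 hT c hc)

/-! ## Part 6. Weight 2: the table and the registered stub

The 12 certificates (one per convergent word of length 2 not over `{1, 3}`) were found by exact
rational elimination (non-two-letter words first; `numerics/certs.py` of the line's session) and
validated numerically on the iterated integrals to `4·10⁻¹⁶`; the kernel re-verifies them here
(e.g. the fifth: `[−1,−1] = dilGen [−1,−1] + ([i,i] + [i,−i] + [−i,i] + [−i,−i])`). -/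

/-- **The weight-2 certificate table** (12 certificates; transcribed from `certs_w2.json`; rationals
`num/den`). [folklore] -/
def certs2 : List Cert := [
  ⟨[1, 0], [([1, 1], -1/3), ([1, 3], 1/3), ([3, 1], -2/3), ([3, 3], 5/3)], [(.inv [1, 0], 5/3),
    (.inv [1, 1], 7/3), (.inv [1, 2], -3), (.inv [2, 0], -2/3), (.inv [2, 1], -5/3),
    (.inv [3, 0], 2/3), (.dil [2, 0], 2/3), (.dil [2, 2], -2/3), (.dil [4, 2], -1/3),
    (.fds [(1, 3)] [(1, 3)], 4/3), (.fds [(1, 3)] [(1, 2)], -1)]⟩,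
  ⟨[1, 2], [([1, 1], 2/3), ([1, 3], 1/3), ([3, 1], 1/3), ([3, 3], -1/3)], [(.inv [1, 0], -1/3),
    (.inv [1, 1], -2/3), (.inv [1, 2], 1), (.inv [2, 0], 1/3), (.inv [2, 1], 1/3),
    (.inv [3, 0], -1/3), (.dil [2, 0], -1/3), (.dil [2, 2], 1/3), (.dil [4, 2], 1/6),
    (.fds [(1, 3)] [(1, 3)], -1/6)]⟩,
  ⟨[2, 0], [([1, 1], 5/3), ([1, 3], 1/3), ([3, 1], 1/3), ([3, 3], 5/3)], [(.inv [1, 0], 2/3),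
    (.inv [1, 1], 4/3), (.inv [1, 2], -2), (.inv [2, 0], 1/3), (.inv [2, 1], -2/3),
    (.inv [3, 0], 2/3), (.dil [2, 0], 2/3), (.dil [2, 2], 1/3), (.dil [4, 2], -1/3),
    (.fds [(1, 3)] [(1, 3)], 4/3)]⟩,
  ⟨[2, 1], [([1, 1], 4/3), ([1, 3], 2/3), ([3, 1], 2/3), ([3, 3], 1/3)], [(.inv [1, 0], 1/3),
    (.inv [1, 1], -1/3), (.inv [2, 0], -1/3), (.inv [2, 1], 2/3), (.inv [3, 0], 1/3),
    (.dil [2, 0], 1/3), (.dil [2, 2], 2/3), (.dil [4, 2], -1/6), (.fds [(1, 3)] [(1, 3)], 1/6)]⟩,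
  ⟨[2, 2], [([1, 1], 1), ([1, 3], 1), ([3, 1], 1), ([3, 3], 1)], [(.dil [2, 2], 1)]⟩,
  ⟨[2, 3], [([1, 1], 1/3), ([1, 3], 2/3), ([3, 1], 2/3), ([3, 3], 4/3)], [(.inv [1, 0], 1/3),
    (.inv [1, 1], 2/3), (.inv [2, 0], -1/3), (.inv [2, 1], -1/3), (.inv [3, 0], 1/3),
    (.dil [2, 0], 1/3), (.dil [2, 2], 2/3), (.dil [4, 2], -1/6), (.fds [(1, 3)] [(1, 3)], 1/6)]⟩,
  ⟨[3, 0], [([1, 1], 5/3), ([1, 3], -2/3), ([3, 1], 1/3), ([3, 3], -1/3)], [(.inv [1, 0], -1/3),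
    (.inv [1, 1], -2/3), (.inv [2, 0], 1/3), (.inv [2, 1], 1/3), (.inv [3, 0], 2/3),
    (.dil [2, 0], -1/3), (.dil [2, 2], 1/3), (.dil [4, 2], -1/3), (.fds [(1, 3)] [(1, 3)], 1/3),
    (.fds [(1, 3)] [(1, 2)], 1)]⟩,
  ⟨[3, 2], [([1, 1], -1/3), ([1, 3], 1/3), ([3, 1], 1/3), ([3, 3], 2/3)], [(.inv [1, 0], -1/3),
    (.inv [1, 1], 1/3), (.inv [2, 0], 1/3), (.inv [2, 1], 1/3), (.inv [3, 0], -1/3),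
    (.dil [2, 0], -1/3), (.dil [2, 2], 1/3), (.dil [4, 2], 1/6), (.fds [(1, 3)] [(1, 3)], -1/6)]⟩,
  ⟨[4, 0], [([1, 1], 4/3), ([1, 3], -4/3), ([3, 1], -4/3), ([3, 3], 4/3)], [(.inv [1, 0], 4/3),
    (.inv [1, 1], 8/3), (.inv [1, 2], -4), (.inv [2, 0], -4/3), (.inv [2, 1], -4/3),
    (.inv [3, 0], 4/3), (.dil [2, 0], 4/3), (.dil [2, 2], -4/3), (.dil [4, 0], -1),
    (.dil [4, 2], -2/3), (.fds [(1, 3)] [(1, 3)], 8/3)]⟩,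
  ⟨[4, 1], [([1, 1], 4/3), ([1, 3], -1/3), ([3, 1], 2/3), ([3, 3], -5/3)], [(.inv [1, 0], -2/3),
    (.inv [1, 1], -7/3), (.inv [1, 2], 2), (.inv [2, 0], 2/3), (.inv [2, 1], 5/3),
    (.inv [3, 0], -2/3), (.dil [2, 0], -2/3), (.dil [2, 2], 2/3), (.dil [4, 2], -1/6),
    (.fds [(1, 3)] [(1, 3)], -5/6), (.fds [(1, 3)] [(1, 2)], 1)]⟩,
  ⟨[4, 2], [([1, 1], -2/3), ([1, 3], 2/3), ([3, 1], 2/3), ([3, 3], -2/3)], [(.inv [1, 0], -2/3),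
    (.inv [1, 1], -4/3), (.inv [1, 2], 2), (.inv [2, 0], 2/3), (.inv [2, 1], 2/3),
    (.inv [3, 0], -2/3), (.dil [2, 0], -2/3), (.dil [2, 2], 2/3), (.dil [4, 2], 1/3),
    (.fds [(1, 3)] [(1, 3)], -4/3)]⟩,
  ⟨[4, 3], [([1, 1], -5/3), ([1, 3], 2/3), ([3, 1], -1/3), ([3, 3], 4/3)], [(.inv [1, 0], 1/3),
    (.inv [1, 1], 5/3), (.inv [1, 2], -1), (.inv [2, 0], -1/3), (.inv [2, 1], -4/3),
    (.inv [3, 0], 1/3), (.dil [2, 0], 1/3), (.dil [2, 2], -1/3), (.dil [4, 2], -1/6),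
    (.fds [(1, 3)] [(1, 3)], 1/6), (.fds [(1, 3)] [(1, 2)], -1)]⟩]

/-- The weight-2 table passes the checker (kernel reflection). [folklore] -/
theorem certs2_ok : certs2.all (Cert.ok 2) = true := by decide +kernel

/-- Coverage: each of the 16 convergent words of length 2 is over `{1, 3}` or in `certs2`.
[folklore] -/
theorem certs2_cover : ∀ W ∈ allWords 2, IsConvergent W →
    (∀ a ∈ W, a = 1 ∨ a = 3) ∨ W ∈ certs2.map Cert.word := by decide +kernel

/-- **Calibration stub, weight 2**: the 16 convergent words of weight 2 reduce to the 4 words over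
`±i` (12 explicit certificates, kernel-checked by reflection). [cite: Zhao2010, §2] -/
theorem stub_weight_two : TwoLetterNormalForm 2 := by
  exact twoLetterNormalForm_of_table 2 certs2 certs2_ok certs2_cover

end Summit.KontsevichZagierPeriods.OctahedralSymmetry.OctaSpan

end
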